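import Mathlib.Analysis.Calculus.Taylor
import Mathlib.Analysis.Calculus.ContDiff.Basic
import Mathlib.Analysis.Calculus.IteratedDeriv.Lemmas
import HarnessLib

/-!
# Taylor's theorem along rays

For a map `g : E → F` between real normed spaces and a direction `v`, the RAY FUNCTION
`rayFun g v : ℝ → F`, `t ↦ g (t • v)`, is a function of one real variable to which Mathlib's
Taylor theorem (`taylor_mean_remainder_bound`) applies. This file records the resulting
"Taylor theorem along rays" in the form used by the local theory of `J`-holomorphic curves
(order of vanishing and leading homogeneous term of a smooth map at a point,
`Literature/Geometry/Symplectic/JHolomorphicCriticalOrder.lean`), avoiding multivariable Taylor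
polynomials altogether:

* `iteratedDeriv_rayFun` — the ray derivatives are the diagonal values of the iterated Fréchet
  derivatives, `(d/dt)^j g(t v) = D^j g (t v) [v, …, v]`; hence (`norm_iteratedDeriv_rayFun_le`)
  `‖(d/dt)^j g(tv)‖ ≤ ‖D^j g (tv)‖ ‖v‖^j` and (`iteratedDeriv_rayFun_smul_zero`) the ray
  derivatives at `0` are homogeneous: `(d/dt)^j g(t s v)|₀ = s^j (d/dt)^j g(t v)|₀`;
* `norm_sub_taylorSum_unitInterval_le` — one-variable Taylor on `[0, 1]`:
  `‖f 1 - Σ_{j ≤ N} f^{(j)}(0)/j!‖ ≤ (sup_{[0,1]} ‖f^{(N+1)}‖) / N!`, and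
  `norm_iteratedDeriv_sub_taylorSum_unitInterval_le`, the same for `f^{(m)}` in place of `f`;
* `norm_sub_raySum_le` — Taylor along the ray:
  `‖g v - Σ_{j ≤ N} (d/dt)^j g(tv)|₀ / j!‖ ≤ K ‖v‖^{N+1} / N!` whenever `‖D^{N+1} g‖ ≤ K` on the
  closed ball of radius `‖v‖`… (stated with `‖v‖ ≤ R` and the bound on `closedBall 0 R`).

Everything is elementary; no named facts.

## References

* [folklore] Taylor's theorem with Lagrange/mean-value remainder applied on segments; e.g.
  H. Cartan, *Calcul différentiel* (1967), I §5.
-/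

noncomputable section

open scoped ContDiff Topology Nat
open Set Metric Finset

namespace Literature.Analysis.Calculus

section Defs

variable {E : Type*} [NormedAddCommGroup E] [NormedSpace ℝ E] {F : Type*}

/-! ### The ray function -/

/-- The **ray function** of `g` in the direction `v`: `t ↦ g (t • v)`. [folklore] -/
def rayFun (g : E → F) (v : E) : ℝ → F := fun t => g (t • v)

/-- Unfolding `rayFun`. [folklore] -/
@[simp] theorem rayFun_apply (g : E → F) (v : E) (t : ℝ) : rayFun g v t = g (t • v) := rfl

/-- The linear parametrisation `t ↦ t • v` of the ray. [folklore] -/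
def rayCLM (v : E) : ℝ →L[ℝ] E := (ContinuousLinearMap.id ℝ ℝ).smulRight v

/-- Unfolding `rayCLM`. [folklore] -/
@[simp] theorem rayCLM_apply (v : E) (t : ℝ) : rayCLM v t = t • v := by
  simp [rayCLM]

/-- The ray function is the composition of `g` with the linear ray. [folklore] -/
theorem rayFun_eq_comp (g : E → F) (v : E) : rayFun g v = g ∘ rayCLM v :=
  funext fun t => by simp

end Defs

variable {E F : Type*} [NormedAddCommGroup E] [NormedSpace ℝ E] [NormedAddCommGroup F]
  [NormedSpace ℝ F]

/-- The ray function of a `Cⁿ` map is `Cⁿ`. [folklore] -/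
theorem contDiff_rayFun {g : E → F} {n : WithTop ℕ∞} (hg : ContDiff ℝ n g) (v : E) :
    ContDiff ℝ n (rayFun g v) := by
  rw [rayFun_eq_comp]
  exact hg.comp (rayCLM v).contDiff

/-- **Ray derivatives are diagonal values of iterated Fréchet derivatives**:
`(d/dt)^j g (t • v) = D^j g (t • v) [v, …, v]`. [folklore] -/
theorem iteratedDeriv_rayFun {g : E → F} {n : WithTop ℕ∞} (hg : ContDiff ℝ n g) (v : E)
    {j : ℕ} (hj : (j : WithTop ℕ∞) ≤ n) (t : ℝ) :
    iteratedDeriv j (rayFun g v) t = iteratedFDeriv ℝ j g (t • v) (fun _ => v) := by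
  rw [iteratedDeriv_eq_iteratedFDeriv, rayFun_eq_comp,
    ContinuousLinearMap.iteratedFDeriv_comp_right (rayCLM v) hg t hj]
  simp [ContinuousMultilinearMap.compContinuousLinearMap_apply]

/-- Norm bound for ray derivatives: `‖(d/dt)^j g(tv)‖ ≤ ‖D^j g (tv)‖ ‖v‖^j`. [folklore] -/
theorem norm_iteratedDeriv_rayFun_le {g : E → F} {n : WithTop ℕ∞} (hg : ContDiff ℝ n g) (v : E)
    {j : ℕ} (hj : (j : WithTop ℕ∞) ≤ n) (t : ℝ) :
    ‖iteratedDeriv j (rayFun g v) t‖ ≤ ‖iteratedFDeriv ℝ j g (t • v)‖ * ‖v‖ ^ j := by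
  rw [iteratedDeriv_rayFun hg v hj t]
  calc ‖iteratedFDeriv ℝ j g (t • v) (fun _ => v)‖
      ≤ ‖iteratedFDeriv ℝ j g (t • v)‖ * ∏ _i : Fin j, ‖v‖ :=
        ContinuousMultilinearMap.le_opNorm _ _
    _ = ‖iteratedFDeriv ℝ j g (t • v)‖ * ‖v‖ ^ j := by rw [prod_const, card_univ, Fintype.card_fin]

/-- **Homogeneity of the ray derivatives at `0`**: `(d/dt)^j g(t s v)|₀ = s^j (d/dt)^j g(tv)|₀`.
[folklore] -/
theorem iteratedDeriv_rayFun_smul_zero {g : E → F} {n : WithTop ℕ∞} (hg : ContDiff ℝ n g)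
    (v : E) {j : ℕ} (hj : (j : WithTop ℕ∞) ≤ n) (s : ℝ) :
    iteratedDeriv j (rayFun g (s • v)) 0 = s ^ j • iteratedDeriv j (rayFun g v) 0 := by
  rw [iteratedDeriv_rayFun hg _ hj, iteratedDeriv_rayFun hg _ hj, zero_smul, zero_smul]
  have h : (fun _ : Fin j => s • v) = fun i => (fun _ : Fin j => s) i • (fun _ : Fin j => v) i :=
    rfl
  rw [h, ContinuousMultilinearMap.map_smul_univ]
  simp [prod_const]

/-- The derivative of the ray function: `(d/dt) g(tv) = Dg(tv) v`. [folklore] -/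
theorem hasDerivAt_rayFun {g : E → F} {t : ℝ} {v : E} (hg : DifferentiableAt ℝ g (t • v)) :
    HasDerivAt (rayFun g v) (fderiv ℝ g (t • v) v) t := by
  have h1 : HasDerivAt (fun s : ℝ => s • v) v t := by
    simpa using (hasDerivAt_id t).smul_const v
  have h2 := hg.hasFDerivAt.comp_hasDerivAt t h1
  exact h2

/-- `deriv (rayFun g v) t = Dg(tv) v` for `g` differentiable at `t • v`. [folklore] -/
theorem deriv_rayFun {g : E → F} {t : ℝ} {v : E} (hg : DifferentiableAt ℝ g (t • v)) :
    deriv (rayFun g v) t = fderiv ℝ g (t • v) v :=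
  (hasDerivAt_rayFun hg).deriv

/-! ### One-variable Taylor on `[0, 1]` -/

/-- Casting helper: `j ≤ N` as an inequality of smoothness exponents `j ≤ N + 1`. [folklore] -/
theorem natCast_le_succ_of_le {j N : ℕ} (h : j ≤ N) :
    ((j : ℕ∞) : WithTop ℕ∞) ≤ ((N + 1 : ℕ) : WithTop ℕ∞) := by
  exact_mod_cast h.trans (Nat.le_succ N)

/-- **Taylor on the unit interval.** For `f : ℝ → F` of class `C^{N+1}` with
`‖f^{(N+1)}‖ ≤ K` on `[0, 1]`:  `‖f 1 - Σ_{j ≤ N} f^{(j)}(0) / j!‖ ≤ K / N!`. [folklore] -/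
theorem norm_sub_taylorSum_unitInterval_le {f : ℝ → F} {N : ℕ} (hf : ContDiff ℝ ((N + 1 : ℕ) : WithTop ℕ∞) f)
    {K : ℝ} (hK : ∀ t ∈ Icc (0 : ℝ) 1, ‖iteratedDeriv (N + 1) f t‖ ≤ K) :
    ‖f 1 - ∑ j ∈ range (N + 1), ((j ! : ℝ)⁻¹) • iteratedDeriv j f 0‖ ≤ K / N ! := by
  have hu : UniqueDiffOn ℝ (Icc (0 : ℝ) 1) := uniqueDiffOn_Icc zero_lt_one
  have hfN : ContDiffOn ℝ (N + 1) f (Icc 0 1) := by exact_mod_cast hf.contDiffOn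
  have h := taylor_mean_remainder_bound (f := f) (a := 0) (b := 1) (C := K) (x := 1) (n := N)
    zero_le_one hfN (by simp) ?_
  · have ht : taylorWithinEval f N (Icc 0 1) 0 1 =
        ∑ j ∈ range (N + 1), ((j ! : ℝ)⁻¹) • iteratedDeriv j f 0 := by
      rw [taylor_within_apply]
      refine sum_congr rfl fun j hj => ?_
      have hjN : j ≤ N := Nat.lt_succ_iff.mp (mem_range.mp hj)
      rw [sub_zero, one_pow, mul_one, iteratedDerivWithin_eq_iteratedDeriv hu
        ((hf.of_le (natCast_le_succ_of_le hjN)).contDiffAt) (by simp)]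
    rw [ht] at h
    simpa using h
  · intro y hy
    rw [iteratedDerivWithin_eq_iteratedDeriv hu (by exact_mod_cast hf.contDiffAt) hy]
    exact hK y hy

/-- Iterated derivatives compose additively: `(f^{(m)})^{(j)} = f^{(j+m)}`. [folklore] -/
theorem iteratedDeriv_iteratedDeriv (f : ℝ → F) (j m : ℕ) :
    iteratedDeriv j (iteratedDeriv m f) = iteratedDeriv (j + m) f := by
  rw [iteratedDeriv_eq_iterate, iteratedDeriv_eq_iterate, iteratedDeriv_eq_iterate,
    ← Function.iterate_add_apply]

/-- **Taylor on the unit interval for a derivative.** For `f` of class `C^{N+1+m}` with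
`‖f^{(N+1+m)}‖ ≤ K` on `[0, 1]`:  `‖f^{(m)} 1 - Σ_{j ≤ N} f^{(j+m)}(0) / j!‖ ≤ K / N!`.
[folklore] -/
theorem norm_iteratedDeriv_sub_taylorSum_unitInterval_le {f : ℝ → F} {N m : ℕ}
    (hf : ContDiff ℝ ((N + 1 + m : ℕ) : WithTop ℕ∞) f)
    {K : ℝ} (hK : ∀ t ∈ Icc (0 : ℝ) 1, ‖iteratedDeriv (N + 1 + m) f t‖ ≤ K) :
    ‖iteratedDeriv m f 1 - ∑ j ∈ range (N + 1), ((j ! : ℝ)⁻¹) • iteratedDeriv (j + m) f 0‖ ≤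
      K / N ! := by
  have hψ : ContDiff ℝ ((N + 1 : ℕ) : WithTop ℕ∞) (iteratedDeriv m f) := by
    rw [iteratedDeriv_eq_iterate]
    exact hf.iterate_deriv' (N + 1) m
  have h := norm_sub_taylorSum_unitInterval_le hψ (K := K) (fun t ht => by
    rw [iteratedDeriv_iteratedDeriv]; exact hK t ht)
  simpa only [iteratedDeriv_iteratedDeriv] using h

/-! ### Taylor along rays -/

/-- **Taylor's theorem along a ray.** If `g : E → F` is `C^{N+1}` with `‖D^{N+1} g‖ ≤ K` on the
closed ball of radius `R` about `0`, then for `‖v‖ ≤ R`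
`‖g v - Σ_{j ≤ N} (d/dt)^j g(tv)|₀ / j!‖ ≤ K ‖v‖^{N+1} / N!`. [folklore] -/
theorem norm_sub_raySum_le {g : E → F} {N : ℕ} (hg : ContDiff ℝ ((N + 1 : ℕ) : WithTop ℕ∞) g)
    {K R : ℝ} (hK : ∀ x ∈ closedBall (0 : E) R, ‖iteratedFDeriv ℝ (N + 1) g x‖ ≤ K)
    {v : E} (hv : ‖v‖ ≤ R) :
    ‖g v - ∑ j ∈ range (N + 1), ((j ! : ℝ)⁻¹) • iteratedDeriv j (rayFun g v) 0‖ ≤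
      K * ‖v‖ ^ (N + 1) / N ! := by
  have hK0 : 0 ≤ K := (norm_nonneg _).trans (hK 0 (by simpa using (norm_nonneg v).trans hv))
  have h := norm_sub_taylorSum_unitInterval_le (contDiff_rayFun hg v) (K := K * ‖v‖ ^ (N + 1)) ?_
  · simpa using h
  · intro t ht
    have htv : t • v ∈ closedBall (0 : E) R := by
      rw [mem_closedBall, dist_zero_right, norm_smul, Real.norm_eq_abs,
        abs_of_nonneg ht.1]
      calc t * ‖v‖ ≤ 1 * ‖v‖ := by gcongr; exact ht.2
        _ ≤ R := by rw [one_mul]; exact hv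
    calc ‖iteratedDeriv (N + 1) (rayFun g v) t‖
        ≤ ‖iteratedFDeriv ℝ (N + 1) g (t • v)‖ * ‖v‖ ^ (N + 1) :=
          norm_iteratedDeriv_rayFun_le hg v le_rfl t
      _ ≤ K * ‖v‖ ^ (N + 1) := by gcongr; exact hK _ htv

/-- **Taylor along a ray for the first derivative**: with `‖D^{N+2} g‖ ≤ K` on the closed ball
of radius `R` and `‖v‖ ≤ R`,
`‖Dg(v) v - Σ_{j ≤ N} (d/dt)^{j+1} g(tv)|₀ / j!‖ ≤ K ‖v‖^{N+2} / N!`. [folklore] -/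
theorem norm_fderiv_sub_raySum_le {g : E → F} {N : ℕ}
    (hg : ContDiff ℝ ((N + 2 : ℕ) : WithTop ℕ∞) g)
    {K R : ℝ} (hK : ∀ x ∈ closedBall (0 : E) R, ‖iteratedFDeriv ℝ (N + 2) g x‖ ≤ K)
    {v : E} (hv : ‖v‖ ≤ R) :
    ‖fderiv ℝ g v v - ∑ j ∈ range (N + 1), ((j ! : ℝ)⁻¹) • iteratedDeriv (j + 1) (rayFun g v) 0‖ ≤
      K * ‖v‖ ^ (N + 2) / N ! := by
  have hK0 : 0 ≤ K := (norm_nonneg _).trans (hK 0 (by simpa using (norm_nonneg v).trans hv))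
  have hf : ContDiff ℝ ((N + 1 + 1 : ℕ) : WithTop ℕ∞) (rayFun g v) := contDiff_rayFun hg v
  have h := norm_iteratedDeriv_sub_taylorSum_unitInterval_le (m := 1) hf (K := K * ‖v‖ ^ (N + 2)) ?_
  · have hd : iteratedDeriv 1 (rayFun g v) 1 = fderiv ℝ g v v := by
      rw [iteratedDeriv_one, deriv_rayFun (by simpa using (hg.differentiable (by simp)) v)]
      simp
    rw [hd] at h
    simpa using h
  · intro t ht
    have htv : t • v ∈ closedBall (0 : E) R := by
      rw [mem_closedBall, dist_zero_right, norm_smul, Real.norm_eq_abs,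
        abs_of_nonneg ht.1]
      calc t * ‖v‖ ≤ 1 * ‖v‖ := by gcongr; exact ht.2
        _ ≤ R := by rw [one_mul]; exact hv
    calc ‖iteratedDeriv (N + 1 + 1) (rayFun g v) t‖
        ≤ ‖iteratedFDeriv ℝ (N + 1 + 1) g (t • v)‖ * ‖v‖ ^ (N + 1 + 1) :=
          norm_iteratedDeriv_rayFun_le hg v (by exact_mod_cast le_rfl) t
      _ ≤ K * ‖v‖ ^ (N + 2) := by gcongr; exact hK _ htv

/-- **Taylor along a ray for the second derivative**: with `‖D^{N+3} g‖ ≤ K` on the closed ball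
of radius `R` and `‖v‖ ≤ R`,
`‖(d/dt)² g(tv)|₁ - Σ_{j ≤ N} (d/dt)^{j+2} g(tv)|₀ / j!‖ ≤ K ‖v‖^{N+3} / N!`. [folklore] -/
theorem norm_iteratedDeriv_two_sub_raySum_le {g : E → F} {N : ℕ}
    (hg : ContDiff ℝ ((N + 3 : ℕ) : WithTop ℕ∞) g)
    {K R : ℝ} (hK : ∀ x ∈ closedBall (0 : E) R, ‖iteratedFDeriv ℝ (N + 3) g x‖ ≤ K)
    {v : E} (hv : ‖v‖ ≤ R) :
    ‖iteratedDeriv 2 (rayFun g v) 1 -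
        ∑ j ∈ range (N + 1), ((j ! : ℝ)⁻¹) • iteratedDeriv (j + 2) (rayFun g v) 0‖ ≤
      K * ‖v‖ ^ (N + 3) / N ! := by
  have hK0 : 0 ≤ K := (norm_nonneg _).trans (hK 0 (by simpa using (norm_nonneg v).trans hv))
  have hf : ContDiff ℝ ((N + 1 + 2 : ℕ) : WithTop ℕ∞) (rayFun g v) := contDiff_rayFun hg v
  refine norm_iteratedDeriv_sub_taylorSum_unitInterval_le (m := 2) hf (K := K * ‖v‖ ^ (N + 3)) ?_
  intro t ht
  have htv : t • v ∈ closedBall (0 : E) R := by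
    rw [mem_closedBall, dist_zero_right, norm_smul, Real.norm_eq_abs, abs_of_nonneg ht.1]
    calc t * ‖v‖ ≤ 1 * ‖v‖ := by gcongr; exact ht.2
      _ ≤ R := by rw [one_mul]; exact hv
  calc ‖iteratedDeriv (N + 1 + 2) (rayFun g v) t‖
      ≤ ‖iteratedFDeriv ℝ (N + 1 + 2) g (t • v)‖ * ‖v‖ ^ (N + 1 + 2) :=
        norm_iteratedDeriv_rayFun_le hg v (by exact_mod_cast le_rfl) t
    _ ≤ K * ‖v‖ ^ (N + 3) := by gcongr; exact hK _ htv

/-- **Vanishing ray jets give a polynomial bound.** If `g` is `C^{N+1}`, `‖D^{N+1} g‖ ≤ K` on the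
closed `R`-ball about `0`, and all ray derivatives of orders `1 ≤ j ≤ N` vanish at `0` in every
direction, then `‖g v - g 0‖ ≤ K ‖v‖^{N+1} / N!` for `‖v‖ ≤ R`. [folklore] -/
theorem norm_sub_le_of_rayDeriv_eq_zero {g : E → F} {N : ℕ}
    (hg : ContDiff ℝ ((N + 1 : ℕ) : WithTop ℕ∞) g)
    {K R : ℝ} (hK : ∀ x ∈ closedBall (0 : E) R, ‖iteratedFDeriv ℝ (N + 1) g x‖ ≤ K)
    (h0 : ∀ (j : ℕ), 1 ≤ j → j ≤ N → ∀ v : E, iteratedDeriv j (rayFun g v) 0 = 0)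
    {v : E} (hv : ‖v‖ ≤ R) :
    ‖g v - g 0‖ ≤ K * ‖v‖ ^ (N + 1) / N ! := by
  have h := norm_sub_raySum_le hg hK hv
  have hsum : ∑ j ∈ range (N + 1), ((j ! : ℝ)⁻¹) • iteratedDeriv j (rayFun g v) 0 = g 0 := by
    rw [sum_range_succ', iteratedDeriv_zero]
    have hz : ∀ j ∈ range N, ((((j + 1)! : ℕ) : ℝ)⁻¹) • iteratedDeriv (j + 1) (rayFun g v) 0 = 0 :=
      fun j hj => by
      rw [h0 (j + 1) (Nat.succ_le_succ (Nat.zero_le j)) (Nat.succ_le_of_lt (mem_range.mp hj)) v,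
        smul_zero]
    rw [sum_eq_zero hz]
    simp
  rwa [hsum] at h

end Literature.Analysis.Calculus

end
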